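import Summits.BirchSwinnertonDyer.Rank1Residual.Additive.SignedSelmerControlZero
import HarnessLib

/-!
# Sub-Selmer families at the bottom layer: `ord_p #S₀ ≤ ord_p f(0)` for ANY `conj`-stable family
# `S_∞ ≤ H¹(K_∞, E[p^∞])` with a Pontryagin-dual pair (cell `b2b-bsdres`, team n1011, r = 1 strand,
# seat p17 GEN 3; row T-O7ss-P13 FILE 1 — additive-p4's `SignedControlZero` (line V18) made
# datum-agnostic, so that Kobayashi's STRICT-minus Selmer structure (prover target (P1) of cc-typer-6's
# `QuadraticBranchOddStrictSelmer.lean`) and any later sub-Selmer condition reuse ONE chain)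

HONEST FRAMING (cell `b2b-bsdres`, run/shared/lean/b2b/bsd-rank1-residual/, verbatim in every
file): the goal of the cell is to DELETE the COMBINATION-SHAPED residual classes of the
Birch–Swinnerton-Dyer formula for ALL analytic-rank `≤ 1` elliptic curves over `ℚ` — "full BSD
formula for every rank `≤ 1` curve in class `C`" assembled STRICTLY from published theorems — so
that the rank-`≤ 1` remainder becomes exactly the CONSTRUCTION-SHAPED classes, which are TYPED
(missing-input `Prop`s), NOT attempted. This is not "finishing BSD". Team n1011: prove what is
provable now; shrink each hard class to its core with data; no claim beyond stated classes; research
routes; census output = EVIDENCE / conjecture items, never a Literature fact; RESIDUAL-MAP marks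
change only by signed lines. O7-ss stays OPEN, X4 CONSTRUCTION-SHAPED; nothing here is booked.
Theorems only (NO definition, NO Literature fact, NO `_holds` of a conjecture); generic algebra and
Galois-cohomology bookkeeping; `#print axioms` standard.

## What

additive-p4's `SignedControlZero.padicValNat_card_selmerGroupPInfty_le` (file
`SignedSelmerControlZero.lean`) bounds `#Sel_{p^∞}(E/K)` by `f^ε(0)` for Kobayashi's signed datum
`SignedSelmerDualData W κ γ ε`. Its proof uses the datum only through (a) the Pontryagin-dual PAIR
`IwasawaDual.IsDualPair p (conj_γ − 1) D.toDual` and (b) the fact that the bottom layer maps, under the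
restriction `h_0 : H¹(K_0, E[p^∞]) → H¹(K_∞, E[p^∞])`, INTO the family and into the `γ`-invariants.
This file states the same chain for an ARBITRARY family:

* §1 `finite_and_padicValNat_card_le_of_injective` — pure `Λ`-algebra: a dual pair `(S, ψ) ↔ X`
  with `X` finitely generated torsion, `char(X) = (f)`, `f(0) ≠ 0`, NO non-trivial finite
  `Λ`-submodule (so `X[T] = 0` and `f(0) = u·#(X/TX) = u·#S^{ψ=0}`, Greenberg Lemma 4.2), and ANY
  group `S₀` injecting into the invariants `S^{ψ = 0}`: `S₀` is finite and `ord_p #S₀ ≤ ord_p f(0)`.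
* §2 `finite_and_padicValNat_card_le` — for `E/K` over a number field, a `ℤ_p`-extension `κ` with
  topological generator `γ`, ANY subgroup `S_∞ ≤ H¹(K_∞, E[p^∞])` with an endomorphism `ψ` acting as
  `conj_γ − 1`, a dual pair for `(S_∞, ψ)`, and ANY subgroup `S₀ ≤ H¹(K_0, E[p^∞])` whose image
  under `h_0` lies in `S_∞`: if `E(K_∞)[p^∞] = 0` (so `h_0` is injective — Kobayashi's Lemma 9.1 /
  Greenberg's Lemma 3.1, the tree's sign-free `SignedControlZero.layerToInfty_zero_injective`) then
  `S₀` is finite and **`ord_p #S₀ ≤ ord_p f(0)`**.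

Consumers: FILE 2b of the row (Kobayashi's odd Selmer structure WITH the `m = −1` clause of §2 /
Def. 2.1, whose bottom layer is the `p`-STRICT Selmer group `Sel_str(W/ℚ)[p^∞]` =
`strictSelmerPInfty W p` of cc-typer-6's p259634) and, unchanged, the signed case (additive-p4's
theorem is the instance `S_∞ = Sel^ε(E/K_∞)`, `S₀ = Sel_{p^∞}(E/K_0)`).

References: [Kobayashi2003] S. Kobayashi, Invent. Math. 152 (2003), §2 p. 4 (the `m = −1` clause),
Lemma 9.1 (p. 25); [GreenbergLNM1716] R. Greenberg, LNM 1716 (1999), §3 Lemma 3.1 (p. 86), §4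
Lemma 4.2 (p. 102).
-/

noncomputable section

open scoped Classical

open WeierstrassCurve Literature.NumberTheory.EllipticCurves Literature.NumberTheory.GaloisRepresentations
  Literature.NumberTheory.EllipticCurves.IwasawaAlgebra Literature.NumberTheory.EllipticCurves.IwasawaDual
  ZpExtension

universe u

namespace Summit.BirchSwinnertonDyer.Rank1Residual.Additive

namespace SubSelmerControlZero

/-! ## §1 `Λ`-algebra: a dual pair and an injection into the invariants -/

section Algebra

variable (p : ℕ) [Fact p.Prime] {S : Type*} [AddCommGroup S] {ψ : AddMonoid.End S}
  {X : Type u} [AddCommGroup X] [Module (IwasawaAlgebra p) X] [Module.Finite (IwasawaAlgebra p) X]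
  {toDual : X →+ (S →+ AddCircle (1 : ℚ))}

/-- **The bottom-layer inequality, algebraic core.** Let `(S, ψ) ↔ X` be a Pontryagin-dual pair
(`IwasawaDual.IsDualPair`: `X ≅ Hom(S, ℚ/ℤ)`, `T ↔ ψ`), `X` finitely generated `Λ`-torsion with
`char(X) = (f)`, `f(0) ≠ 0`, and assume `X` has NO non-trivial finite `Λ`-submodule. Then for every
group `S₀` injecting into the invariants `S^{ψ=0}`: `S₀` is finite and **`ord_p #S₀ ≤ ord_p f(0)`** —
`#S₀ ∣ #S^{ψ=0} = #(X/TX)` (`IsDualPair.natCard_coinvariants`) and `f(0) = u · #(X/TX)`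
(Greenberg's Lemma 4.2 with `X[T] = 0`, additive-p4's
`SignedControlZero.exists_constantCoeff_eq_unit_mul_natCard_coinvariants`).
[cite: GreenbergLNM1716, §4 Lemma 4.2 (p. 102)] -/
theorem finite_and_padicValNat_card_le_of_injective (h : IsDualPair p ψ toDual)
    (hX : Module.IsTorsion (IwasawaAlgebra p) X)
    (hnf : ∀ N : Submodule (IwasawaAlgebra p) X, Finite N → N = ⊥)
    {f : IwasawaAlgebra p} (hf : Module.charIdeal (IwasawaAlgebra p) X = Ideal.span {f})
    (h0 : PowerSeries.constantCoeff f ≠ 0)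
    {S₀ : Type*} [AddGroup S₀] (φ : S₀ →+ endInvariants ψ) (hφ : Function.Injective φ) :
    Finite S₀ ∧
      (padicValNat p (Nat.card S₀) : ℤ) ≤
        ((PowerSeries.constantCoeff f : ℤ_[p]) : ℚ_[p]).valuation := by
  obtain ⟨hcoinv, u, hu⟩ :=
    SignedControlZero.exists_constantCoeff_eq_unit_mul_natCard_coinvariants p X hX f hf h0 hnf
  -- `#(X/TX) = #S^{ψ=0}`, finite
  have hcardS : Nat.card (coinvariants p X) = Nat.card (endInvariants ψ) := h.natCard_coinvariants
  haveI hSfin : Finite (endInvariants ψ) := h.finite_coinvariants_iff.mp hcoinv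
  -- `#S₀ ∣ #S^{ψ=0}`
  have hdvd : Nat.card S₀ ∣ Nat.card (endInvariants ψ) := AddSubgroup.card_dvd_of_injective φ hφ
  have hSpos : 0 < Nat.card (endInvariants ψ) := Nat.card_pos
  have hne : Nat.card S₀ ≠ 0 := fun h' ↦ by
    rw [h'] at hdvd
    exact hSpos.ne' (Nat.eq_zero_of_zero_dvd hdvd)
  have hfin : Finite S₀ := Nat.finite_of_card_ne_zero hne
  refine ⟨hfin, ?_⟩
  have hle : padicValNat p (Nat.card S₀) ≤ padicValNat p (Nat.card (endInvariants ψ)) := by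
    rw [← padicValNat_dvd_iff_le hSpos.ne']
    exact (pow_padicValNat_dvd).trans hdvd
  have hval : ((PowerSeries.constantCoeff f : ℤ_[p]) : ℚ_[p]).valuation =
      (padicValNat p (Nat.card (endInvariants ψ)) : ℤ) := by
    have hcast : ((PowerSeries.constantCoeff f : ℤ_[p]) : ℚ_[p]) =
        ((u : ℤ_[p]) : ℚ_[p]) * ((Nat.card (endInvariants ψ) : ℕ) : ℚ_[p]) := by
      rw [hu, ← hcardS, PadicInt.coe_mul, PadicInt.coe_natCast]
    rw [hcast, Padic.valuation_mul (coe_units_ne_zero p u) (by exact_mod_cast hSpos.ne'),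
      valuation_coe_units_eq_zero, zero_add, Padic.valuation_natCast]
  rw [hval]
  exact_mod_cast hle

end Algebra

/-! ## §2 Sub-Selmer families: the bottom layer injects into the `γ`-invariants of the family -/

section Selmer

variable {K : Type u} [Field K] [NumberField K] (W : WeierstrassCurve K) {p : ℕ} [Fact p.Prime]
  {κ : ZpExtension K p} {γ : Field.absoluteGaloisGroup K}

/-- **The bottom layer of a sub-Selmer family injects into its `γ`-invariants.** Let
`S_∞ ≤ H¹(K_∞, E[p^∞])` be any subgroup, `ψ` an endomorphism of `S_∞` acting as `conj_γ − 1`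
(`hψ`), and `S₀ ≤ H¹(K_0, E[p^∞])` any subgroup whose image under the restriction
`h_0 = layerToInfty κ 0` lies in `S_∞`. If `E(K_∞)[p^∞] = 0` then `h_0` is injective (Kobayashi's
Lemma 9.1 / Greenberg's Lemma 3.1: additive-p4's sign-free `SignedControlZero.layerToInfty_zero_injective`)
and its image is fixed by `conj_γ` (`range_layerToInfty_le_layerInvariants_holds`), so `h_0` induces
an INJECTIVE homomorphism `S₀ →+ S_∞^{ψ=0}`. [cite: Kobayashi2003, Lemma 9.1 (p. 25)]
[cite: GreenbergLNM1716, §3 Lemma 3.1 (p. 86)] -/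
theorem exists_injective_toEndInvariants (hγ : κ.IsTopGenerator γ)
    (hB : FixedPoints.addSubgroup κ.kerSubgroup (W.geomPrimaryTorsion p) = ⊥)
    {Sinf : AddSubgroup (W.subgroupH1 p κ.kerSubgroup)} {ψ : AddMonoid.End Sinf}
    (hψ : ∀ s : Sinf, ((ψ s : Sinf) : W.subgroupH1 p κ.kerSubgroup) =
      W.conjH1 p κ.kerSubgroup γ (s : W.subgroupH1 p κ.kerSubgroup) - s)
    (S₀ : AddSubgroup (W.subgroupH1 p (κ.layerSubgroup 0)))
    (hS₀ : S₀.map (W.layerToInfty κ 0) ≤ Sinf) :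
    ∃ φ : S₀ →+ endInvariants ψ, Function.Injective φ ∧
      ∀ c : S₀, ((φ c : Sinf) : W.subgroupH1 p κ.kerSubgroup) =
        W.layerToInfty κ 0 (c : W.subgroupH1 p (κ.layerSubgroup 0)) := by
  -- the image of `h_0` lies in `S_∞`
  have hmem : ∀ c : S₀, W.layerToInfty κ 0 (c : W.subgroupH1 p (κ.layerSubgroup 0)) ∈ Sinf :=
    fun c ↦ hS₀ ⟨c, c.2, rfl⟩
  -- and is fixed by `conj_γ`
  have hfix : ∀ c : S₀, (⟨W.layerToInfty κ 0 (c : W.subgroupH1 p (κ.layerSubgroup 0)), hmem c⟩ : Sinf) ∈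
      endInvariants ψ := by
    intro c
    rw [mem_endInvariants_iff]
    apply Subtype.ext
    rw [hψ, ZeroMemClass.coe_zero, sub_eq_zero]
    have hinv := W.range_layerToInfty_le_layerInvariants_holds κ 0
      ⟨(c : W.subgroupH1 p (κ.layerSubgroup 0)), rfl⟩
    rw [mem_layerInvariants_iff] at hinv
    exact hinv γ (by rw [ZpExtension.layerSubgroup_zero]; exact Subgroup.mem_top γ)
  let φ : S₀ →+ endInvariants ψ :=
    { toFun := fun c ↦ ⟨⟨W.layerToInfty κ 0 (c : W.subgroupH1 p (κ.layerSubgroup 0)), hmem c⟩, hfix c⟩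
      map_zero' := by
        apply Subtype.ext; apply Subtype.ext
        simp only [ZeroMemClass.coe_zero, map_zero]
      map_add' := fun a b ↦ by
        apply Subtype.ext; apply Subtype.ext
        simp only [AddSubgroup.coe_add, map_add] }
  refine ⟨φ, fun a b hab ↦ ?_, fun c ↦ rfl⟩
  have h := congrArg (fun z : endInvariants ψ ↦ ((z : Sinf) : W.subgroupH1 p κ.kerSubgroup)) hab
  exact Subtype.ext (SignedControlZero.layerToInfty_zero_injective W hγ hB h)

/-- **The bottom-layer inequality for an arbitrary sub-Selmer family.** Let `E/K` be an elliptic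
curve over a number field, `κ` a `ℤ_p`-extension with topological generator `γ`, `S_∞ ≤
H¹(K_∞, E[p^∞])` ANY subgroup with an endomorphism `ψ` acting as `conj_γ − 1`, `(S_∞, ψ) ↔ X` a
Pontryagin-dual pair with `X` finitely generated `Λ`-torsion, `char(X) = (f)`, `f(0) ≠ 0` and NO
non-trivial finite `Λ`-submodule, and `S₀ ≤ H¹(K_0, E[p^∞])` ANY subgroup mapping into `S_∞` under
`h_0`. If `E(K_∞)[p^∞] = 0`, then `S₀` is finite and **`ord_p #S₀ ≤ ord_p f(0)`**. For `S_∞ =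
Sel^ε(E/K_∞)`, `S₀ = Sel_{p^∞}(E/K_0)` this is additive-p4's `SignedControlZero.padicValNat_card_
selmerGroupPInfty_le`; for Kobayashi's STRICT-minus structure (the `m = −1` clause of §2 / Def. 2.1)
it bounds the `p`-strict Selmer group (row T-O7ss-P13, FILES 2–3). The INEQUALITY form of the
bottom-layer Euler characteristic — what is available over a base in which `p` ramifies.
[cite: Kobayashi2003, Lemma 9.1 (p. 25) and §2 (p. 4)] [cite: GreenbergLNM1716, §4 Lemma 4.2 (p. 102)] -/
theorem finite_and_padicValNat_card_le (hγ : κ.IsTopGenerator γ)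
    (hB : FixedPoints.addSubgroup κ.kerSubgroup (W.geomPrimaryTorsion p) = ⊥)
    {Sinf : AddSubgroup (W.subgroupH1 p κ.kerSubgroup)} {ψ : AddMonoid.End Sinf}
    (hψ : ∀ s : Sinf, ((ψ s : Sinf) : W.subgroupH1 p κ.kerSubgroup) =
      W.conjH1 p κ.kerSubgroup γ (s : W.subgroupH1 p κ.kerSubgroup) - s)
    {X : Type u} [AddCommGroup X] [Module (IwasawaAlgebra p) X] [Module.Finite (IwasawaAlgebra p) X]
    {toDual : X →+ (Sinf →+ AddCircle (1 : ℚ))} (hpair : IsDualPair p ψ toDual)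
    (hX : Module.IsTorsion (IwasawaAlgebra p) X)
    (hnf : ∀ N : Submodule (IwasawaAlgebra p) X, Finite N → N = ⊥)
    {f : IwasawaAlgebra p} (hf : Module.charIdeal (IwasawaAlgebra p) X = Ideal.span {f})
    (h0 : PowerSeries.constantCoeff f ≠ 0)
    (S₀ : AddSubgroup (W.subgroupH1 p (κ.layerSubgroup 0)))
    (hS₀ : S₀.map (W.layerToInfty κ 0) ≤ Sinf) :
    Finite S₀ ∧
      (padicValNat p (Nat.card S₀) : ℤ) ≤
        ((PowerSeries.constantCoeff f : ℤ_[p]) : ℚ_[p]).valuation := by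
  obtain ⟨φ, hφ, -⟩ := exists_injective_toEndInvariants W hγ hB hψ S₀ hS₀
  exact finite_and_padicValNat_card_le_of_injective p hpair hX hnf hf h0 φ hφ

end Selmer

end SubSelmerControlZero

end Summit.BirchSwinnertonDyer.Rank1Residual.Additive

end
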